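import Summits.ABC.IUTFork.Thm311RealInd1StripPacketBoxDefect
import Literature.IUT.LogVolume.PacketDifferent
import Literature.IUT.LogVolume.DifferentEstimatesCorollaries
import Literature.IUT.LogVolume.IntegerRingFinite
import HarnessLib

/-!
# [IUTchIII] Thm 3.11 (i) (Ind1)+(Ind2) on a TWO-FACTOR genuine packet `K_{w₀} ⊗ K_{w₁}`: the UNCONDITIONAL converses of the monomial-floor junction —
# under FAILING depth-`e` bits the `(R_I)^∼`-hull of the strip orbit of the Θ-region `ι_{i₀}(g)·(R_I)^∼` is CONFINED to a polydisc strictly inside the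
# container as soon as the arithmetic room is exhausted: `e_{i₀} ∣ v` (¬bit at EITHER factor) or `e_{i₀} ∣ v + 1` (¬bit at BOTH factors)

PROOF-ONLY file (abc-iut cell, Cor. 3.12 sub-crew, seat abc-iut-c312-1 = holder of record of the typed [IUTchIII] Thm. 3.11, gen 19; row «R25 =
C:NORMALISATION-TRANSFER», KEY NORMTRANSFER, C LEAD ruling C-R167 (a); file (B)).  TAKES NO SIDE on [IUTchIII] Cor. 3.12.  No definition, no `Prop` fact,
NO `JannsenWingbergMappingClass`: every theorem here is UNCONDITIONAL (a failing bit is a displayed binder `hfix`, as in p550084 / p554348).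
SETTING.  Genuine packet `X = K_{w_{i₀}} ⊗_{ℚ_p} K_{w_{i₁}}` (index set `{i₀, i₁}`; `w_{i₀} = w_{i₁}` allowed), both factors TAME; `‖g‖ = p^{−v/E}`,
`E = e(w_{i₀}|p)`, `e₁ = e(w_{i₁}|p)`, `v − 1 = E·B + r`; container `p^{A}·log_p(R_I^×)`, `A = B − 1`, whose span attains the component radius
`R = p^{−A−1/E−1/e₁}` (co-radial log-units, p527172); `H ≤ Aut_{ℚ_p}(X)` acting FACTORWISE through the realised strip groups (p554348 §2).
MECHANISM ([IUTchIV] Prop. 1.1, abc-iut-S5 `prop11_holds`): for a generator `d` of the different of a tame factor (`‖d‖ = p^{−(e−1)/e}`), `ι(d)·(R_I)^∼ ⊆ R_I`;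
so the Θ-region lies in ONE box `⊗(h₀, h₁)·R_I` — `(g·d₀⁻¹, 1)` or `(g, d₁⁻¹)` — whose factor balls are, in the three cases below, either `c·log_p(𝒪^×)`
(mapped into itself by the whole strip group, p554348 §1) or a depth-`e` ball `c·𝔪^{e}` at a residue-degree-one factor with a FAILING bit (mapped onto
itself, p550084); hence every element of the `H`-orbit has Wedderburn components `≤ ‖h₀‖·‖h₁‖ =: R'`, and so has its `(R_I)^∼`-hull (§1 engine).
* §1 engine `packetHull_iUnion_image_subset_polydisc_of_subset_smul_integerPacket` (any number of factors) · `norm_of_apply_le_of_mem_closure_of_le`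
  (the strip group preserves every ball `{‖x‖ ≤ ‖c‖·p^{−1/e}}`) · `normalizedPacket_subset_iota_smul_integerPacket_of_two` (Prop. 1.1 as a box bound) ·
  `exists_mem_zpow_smul_logPacket_not_mem_polydisc` (the container span leaves every polydisc of radius `< ‖p^{A}‖·∏ p^{−1/e_i}`).
* §2 **`…_subset_polydisc_of_dvd_of_fixesBaseLine_offSlot`** — `E ∣ v` (`r = E − 1`), ¬bit at `w_{i₁}` (`f = 1`): hull ⊆ polydisc(`‖g‖·p^{1−1/E}` `= p^{−B−1/E}`)
  — container radius `p^{−B+1−1/E−1/e₁}`, defect `(e₁−1)/e₁·log p`.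
* §3 **`…_subset_polydisc_of_dvd_of_fixesBaseLine_slot`** — `E ∣ v`, ¬bit at `w_{i₀}` (`f = 1`): hull ⊆ polydisc(`‖g‖·p^{1−1/e₁}`) — defect `(E−1)/E·log p`.
* §4 **`…_subset_polydisc_of_dvd_succ_of_fixesBaseLine`** — `E ∣ v + 1` (`r = E − 2`), ¬bit at BOTH factors (`f = 1` both): hull ⊆ polydisc(`‖g‖·p^{1−1/E}`
  `= p^{−B}`) — defect `(1 − 1/E − 1/e₁)·log p`, positive unless `E = e₁ = 2`.
READING (numbers about OUR typed objects; neutral).  With files (A)/(A′) `Thm311RealInd1StripPacketMonomialFloor[Forms]` (mod hMC): at two equally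
ramified tame factors of residue degree one (`e ≥ 3`, odd local degree) the junction identity holds with NO bit for `r ≤ e − 3` ((A′) §1: `(r+2)/e + 1/e ≤ 1`),
with ONE bit at EITHER factor for `r = e − 2` ((A′) §2: `(r+1)/e + 1/e ≤ 1`), with BOTH bits for `r = e − 1` (R24 p552192), and THIS file shows each is
SHARP: the per-factor bit family of R24 is NECESSARY exactly when `e ∣ v`, and is otherwise weakened by depth transfer through `(R_I)^∼ ⊋ R_I`.  Which
value the bit takes at a given place is NOT claimed.  HONEST SCOPE: unconditional; OUR typings (THE equivariant lift, THE logarithm, factorwise action;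
F-B28-1 untouched); EVEN degree, WILD, `p = 2` outside; equal-AS-TYPED ≠ equal in print; nothing here asserts that abc is proved or refuted; no side
taken on [IUTchIII] Cor. 3.12 / [IUTchIV] Thm. 1.10, on (U) vs (P), or on any author. [claim: Mochizuki2012, status: disputed];
[cite: Mochizuki2012, IUTchIII Thm. 3.11 (i) p. 154; Rmk. 3.9.5 (i) p. 127; Cor. 3.12 Step (xi) p. 183; IUTchIV Prop. 1.1 p. 9, Prop. 1.2 (ii) pp. 10–11, Prop. 1.4 (i) p. 13];
[cite: DupuyHilado2025, §4.9, §4.12]; [cite: SerreLocalFields1979, Ch. III §6 Prop. 13]. typed ≠ proved.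
-/

set_option autoImplicit false

noncomputable section

open Metric Set Bornology Function
open scoped Pointwise TensorProduct NormedField

namespace Summit.ABC.IUTFork.Thm311.Real

open NumberField IsDedekindDomain Literature.NumberTheory.NumberFields Literature.IUT.LogVolume
open Literature.NumberTheory.GaloisRepresentations Literature.NumberTheory.GaloisRepresentations.Ultrametric
open Literature.AnabelianGeometry.AbsoluteAnabelian Literature.IUT.HodgeArakelov
open Literature.IUT.HodgeArakelov.AbsTopMonoids

/-! ## §1a Any family of local fields: Prop. 1.1 as a box bound; tame different generators -/

section Abstract

variable (p : ℕ) [hp : Fact p.Prime] {I : Type} [Fintype I] [DecidableEq I]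
variable (k : I → Type) [∀ i, NontriviallyNormedField (k i)] [∀ i, NormedAlgebra ℚ_[p] (k i)]
  [∀ i, IsUltrametricDist (k i)] [∀ i, ProperSpace (k i)]

/-- **[IUTchIV] Prop. 1.1 as a BOX bound on a TWO-factor packet (UNCONDITIONAL):** `(R_I)^∼ ⊆ ι_{i₀}(d⁻¹)·R_I` for a generator `d` of the different of
`k_{i₀}` — since `ι_{i₀}(d)·(R_I)^∼ = (d ⊗ 1)·(R_I)^∼ ⊆ R_I` (abc-iut-S5 `prop11_holds`, slot `⋆ = i₁`). [cite: Mochizuki2012, IUTchIV Prop. 1.1 p. 9] -/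
theorem normalizedPacket_subset_iota_smul_integerPacket_of_two (i₀ i₁ : I) (hne : i₀ ≠ i₁)
    (huniv : (Finset.univ : Finset I) = {i₀, i₁}) (d : Valued.integer (k i₀))
    (hd : different p (k i₀) = Ideal.span {d}) (hd0 : (d : k i₀) ≠ 0) :
    (normalizedPacket p k : Set (PacketAlgebra p k)) ⊆ iota p k i₀ ((d : k i₀))⁻¹ • (integerPacket p k : Set (PacketAlgebra p k)) := by
  have hI : 2 ≤ Fintype.card I := by rw [← Finset.card_univ, huniv, Finset.card_pair hne]
  have h11 := (prop11_holds p k hI i₁ (update (fun i => 1) i₀ d) (fun i hi => ?_) (update_of_ne hne.symm _ _)).1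
  · intro x hx
    refine Set.mem_smul_set.mpr ⟨_, h11 x hx, ?_⟩
    rw [smul_eq_mul, ← mul_assoc, iota_eq_purePacket, purePacket_mul]
    have h1 : purePacket p k (Pi.mulSingle i₀ ((d : k i₀))⁻¹ *
        fun i => ((update (fun i => (1 : Valued.integer (k i))) i₀ d i : Valued.integer (k i)) : k i)) = 1 := by
      rw [← purePacket_one p k]
      congr 1
      funext i
      by_cases hi : i = i₀
      · subst hi; simp [hd0]
      · simp [hi]
    rw [h1, one_mul]
  · have h : i = i₀ := by
      have hm := Finset.mem_univ i
      rw [huniv, Finset.mem_insert, Finset.mem_singleton] at hm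
      exact hm.resolve_right hi
    subst h
    rw [update_self]; exact hd

/-- A generator of the different of a TAME local field has norm `p^{−(e−1)/e}` ([cite: SerreLocalFields1979, Ch. III §6 Prop. 13]; tree:
`exists_different_eq_span`, `differentOrd_eq_of_not_dvd`, `norm_eq_rpow_neg_differentOrd`). -/
theorem exists_different_generator_norm_eq (K : Type) [NontriviallyNormedField K] [NormedAlgebra ℚ_[p] K] [IsUltrametricDist K] [ProperSpace K]
    (he : absRamificationIdx p K ≤ p - 2) :
    ∃ d : Valued.integer K, different p K = Ideal.span {d} ∧ (d : K) ≠ 0 ∧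
      ‖(d : K)‖ = (p : ℝ) ^ (-(((absRamificationIdx p K : ℝ) - 1) / (absRamificationIdx p K : ℝ))) := by
  obtain ⟨d, hd⟩ := exists_different_eq_span p K
  have hd0 : d ≠ 0 := by
    intro h0
    apply different_ne_bot p K
    rw [hd, h0, Ideal.span_singleton_eq_bot]
  have hndvd : ¬ p ∣ absRamificationIdx p K := by
    intro hdv
    have h1 := Nat.le_of_dvd (absRamificationIdx_pos p K) hdv
    have h2 := (Fact.out : p.Prime).two_le
    omega
  refine ⟨d, hd, by exact_mod_cast hd0, ?_⟩
  rw [norm_eq_rpow_neg_differentOrd p K hd hd0, differentOrd_eq_of_not_dvd p K hndvd]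

end Abstract

/-! ## §1b Genuine factors: the engine — a box with strip-stable factor balls confines the hull of the orbit -/

variable {K : Type} [Field K] [NumberField K] (p : ℕ) [hp : Fact p.Prime]
variable {I : Type} [Fintype I] [DecidableEq I] (w : I → HeightOneSpectrum (𝓞 K)) (hw : ∀ i, ((p : ℕ) : 𝓞 K) ∈ (w i).asIdeal)

/-- **ENGINE (UNCONDITIONAL).**  Genuine packet `X = ⊗_i K_{w_i}`; `H ≤ Aut_{ℚ_p}(X)` acting factorwise through the realised strip GROUPS (p554348 §2);
a region `M ⊆ ⊗(h_i)·R_I`; radii `ρ_i ≥ ‖h_i‖` such that at every factor the whole strip group maps the ball `{‖x‖ ≤ ρ_i}` into itself.  Then the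
`(R_I)^∼`-hull of the `H`-orbit of `M` lies in the polydisc of radius `∏ ρ_i` in every Wedderburn component: the elements `z` with `‖(γ(⊗h·z))_j‖ ≤ ∏ρ_i`
for all `γ ∈ H`, `j` form an additive subgroup (ultrametric components) containing the integral pure tensors (`γ(⊗ h_i y_i) = ⊗ δ_i(h_i y_i)`, factor
norms `≤ ρ_i`), hence `R_I` (`integerPacket_le_of_forall_purePacket_mem`); a bounded set has its hull in the polydisc of its radii.
[claim: Mochizuki2012, status: disputed] [cite: Mochizuki2012, IUTchIII Thm. 3.11 (i) p. 154; IUTchIV Prop. 1.1 p. 9] [cite: DupuyHilado2025, §4.12] -/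
theorem packetHull_iUnion_image_subset_polydisc_of_subset_smul_integerPacket [Nonempty I]
    (h : Π i, RescaledCompletion K p (w i) (hw i)) (ρ : I → ℝ) (hρ0 : ∀ i, 0 ≤ ρ i) (hρ : ∀ i, ‖h i‖ ≤ ρ i)
    (hstab : ∀ i, ∀ δ ∈ AddSubgroup.closure (G := AddAut ((w i).adicCompletion K)) (ind1StripOf (w i) (galoisLog (w i))),
      ∀ y : (w i).adicCompletion K, ‖RescaledCompletion.of K p (w i) (hw i) y‖ ≤ ρ i →
        ‖RescaledCompletion.of K p (w i) (hw i) (δ y)‖ ≤ ρ i)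
    (H : Subgroup (PacketAlgebra p (fun i => RescaledCompletion K p (w i) (hw i)) ≃ₗ[ℚ_[p]]
      PacketAlgebra p (fun i => RescaledCompletion K p (w i) (hw i))))
    (hHfac : ∀ γ ∈ H, ∃ δ : Π i, AddAut ((w i).adicCompletion K),
      (∀ i, δ i ∈ AddSubgroup.closure (G := AddAut ((w i).adicCompletion K)) (ind1StripOf (w i) (galoisLog (w i)))) ∧
      ∀ z : Π i, RescaledCompletion K p (w i) (hw i),
        γ (PiTensorProduct.tprod ℚ_[p] z) =
          PiTensorProduct.tprod ℚ_[p] (fun i => RescaledCompletion.of K p (w i) (hw i)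
            (δ i ((RescaledCompletion.of K p (w i) (hw i)).symm (z i)))))
    {M : Set (PacketAlgebra p (fun i => RescaledCompletion K p (w i) (hw i)))}
    (hM : M ⊆ purePacket p (fun i => RescaledCompletion K p (w i) (hw i)) h •
      (integerPacket p (fun i => RescaledCompletion K p (w i) (hw i)) : Set (PacketAlgebra p (fun i => RescaledCompletion K p (w i) (hw i))))) :
    packetHull p (fun i => RescaledCompletion K p (w i) (hw i))
        (⋃ γ : H, (γ : PacketAlgebra p (fun i => RescaledCompletion K p (w i) (hw i)) ≃ₗ[ℚ_[p]]
            PacketAlgebra p (fun i => RescaledCompletion K p (w i) (hw i))) '' M) ⊆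
      dEquiv p (fun i => RescaledCompletion K p (w i) (hw i)) ⁻¹'
        polydisc (DFac p (fun i => RescaledCompletion K p (w i) (hw i))) (fun _ => ∏ i, ρ i) := by
  classical
  set k := fun i => RescaledCompletion K p (w i) (hw i) with hk
  set e := fun i => RescaledCompletion.of K p (w i) (hw i) with he_def
  set R : ℝ := ∏ i, ρ i with hR
  have hR0 : 0 ≤ R := Finset.prod_nonneg fun i _ => hρ0 i
  -- the elements whose whole `H`-orbit (after the box twist `⊗h`) has components `≤ R` form an additive subgroup
  let Λ : AddSubgroup (PacketAlgebra p k) :=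
    { carrier := {z | ∀ γ : PacketAlgebra p k ≃ₗ[ℚ_[p]] PacketAlgebra p k, γ ∈ H →
        ∀ j, ‖dEquiv p k (γ (purePacket p k h * z)) j‖ ≤ R}
      add_mem' := by
        intro a b ha hb γ hγ j
        rw [mul_add, map_add, map_add, Pi.add_apply]
        exact (IsUltrametricDist.norm_add_le_max _ _).trans (max_le (ha γ hγ j) (hb γ hγ j))
      zero_mem' := by
        intro γ hγ j
        rw [mul_zero, map_zero, map_zero, Pi.zero_apply, norm_zero]
        exact hR0
      neg_mem' := by
        intro a ha γ hγ j
        rw [mul_neg, map_neg, map_neg, Pi.neg_apply, norm_neg]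
        exact ha γ hγ j }
  -- integral pure tensors lie in `Λ`
  have hpure : ∀ y : Π i, k i, (∀ i, ‖y i‖ ≤ 1) → purePacket p k y ∈ Λ := by
    intro y hy γ hγ j
    obtain ⟨δ, hδ, hγz⟩ := hHfac γ hγ
    have himg : γ (purePacket p k h * purePacket p k y) =
        PiTensorProduct.tprod ℚ_[p] (fun i => e i (δ i ((e i).symm (h i * y i)))) := by
      rw [purePacket_mul]
      exact hγz (h * y)
    have hcomp : ‖dEquiv p k (PiTensorProduct.tprod ℚ_[p] (fun i => e i (δ i ((e i).symm (h i * y i))))) j‖ =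
        ∏ i, ‖e i (δ i ((e i).symm (h i * y i)))‖ := by
      have h1 := psi_purePacket_apply p k (DFac p k) (dEquiv p k) (fun i => e i (δ i ((e i).symm (h i * y i)))) j
      simp only [purePacket] at h1
      rw [h1, norm_prod]
      exact Finset.prod_congr rfl fun i _ => norm_factorEmb p k (DFac p k) (dEquiv p k) i j _
    change ‖dEquiv p k (γ (purePacket p k h * purePacket p k y)) j‖ ≤ R
    rw [himg, hcomp]
    refine Finset.prod_le_prod (fun i _ => norm_nonneg _) fun i _ => hstab i _ (hδ i) _ ?_
    rw [(e i).apply_symm_apply, norm_mul]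
    calc ‖h i‖ * ‖y i‖ ≤ ρ i * 1 := mul_le_mul (hρ i) (hy i) (norm_nonneg _) (hρ0 i)
      _ = ρ i := mul_one _
  have hRI : (integerPacket p k).toAddSubgroup ≤ Λ := integerPacket_le_of_forall_purePacket_mem p k hpure
  -- every element of the orbit is bounded by `R` in every component
  set O := ⋃ γ : H, (γ : PacketAlgebra p k ≃ₗ[ℚ_[p]] PacketAlgebra p k) '' M with hO
  have hOle : ∀ y ∈ O, ∀ j, ‖dEquiv p k y j‖ ≤ R := by
    intro y hy j
    obtain ⟨γ, hy'⟩ := Set.mem_iUnion.mp hy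
    obtain ⟨m, hm, rfl⟩ := hy'
    obtain ⟨r, hr, rfl⟩ := Set.mem_smul_set.mp (hM hm)
    exact hRI (show r ∈ (integerPacket p k).toAddSubgroup from hr) _ γ.2 j
  have hObdd : IsBounded (dEquiv p k '' O) := by
    refine (isBounded_polydisc (DFac p k) (fun _ => R)).subset ?_
    rintro _ ⟨y, hy, rfl⟩
    exact (mem_polydisc (DFac p k)).mpr (hOle y hy)
  have hrad : ∀ j, hullRadius (DFac p k) (dEquiv p k '' O) j ≤ R := fun j =>
    hullRadius_le_of_nonneg (DFac p k) hR0 (by rintro _ ⟨y, hy, rfl⟩; exact hOle y hy j)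
  intro y hy
  rw [packetHull_eq_preimage_holomorphicHull p k (DFac p k) (dEquiv p k) hObdd, Set.mem_preimage,
    holomorphicHull_of_isBounded (DFac p k) hObdd, mem_polydisc] at hy
  exact (mem_polydisc (DFac p k)).mpr fun j => (hy j).trans (hrad j)

/-- **The whole strip group preserves every log-shell ball `{‖x‖ ≤ ‖c‖·p^{−1/e}}`** (`c ∈ ℚ_p^×`; tame): these are the balls `c·log_p(𝒪_v^×)`
(`log_p(𝒪_v^×) = {‖x‖ < 1} = {‖x‖ ≤ p^{−1/e}}` at a tame place), which the strip group maps into themselves (p554348 §1). UNCONDITIONAL.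
[claim: Mochizuki2012, status: disputed] [cite: Mochizuki2012, IUTchIII Thm. 3.11 (i) p. 154; IUTchIV Prop. 1.2 (ii) p. 10] -/
theorem norm_of_apply_le_of_mem_closure_of_le (v : HeightOneSpectrum (𝓞 K)) (hv : ((p : ℕ) : 𝓞 K) ∈ v.asIdeal) (hp2 : 2 < p)
    (he : absRamificationIdx p (RescaledCompletion K p v hv) ≤ p - 2) {c : ℚ_[p]} (hc : c ≠ 0)
    {γ : AddAut (v.adicCompletion K)}
    (hγ : γ ∈ AddSubgroup.closure (G := AddAut (v.adicCompletion K)) (ind1StripOf v (galoisLog v)))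
    {y : v.adicCompletion K}
    (hy : ‖RescaledCompletion.of K p v hv y‖ ≤ ‖c‖ * (p : ℝ) ^ (-(1 / (absRamificationIdx p (RescaledCompletion K p v hv) : ℝ)))) :
    ‖RescaledCompletion.of K p v hv (γ y)‖ ≤ ‖c‖ * (p : ℝ) ^ (-(1 / (absRamificationIdx p (RescaledCompletion K p v hv) : ℝ))) := by
  have hP : p.Prime := Fact.out
  have hp1 : (1 : ℝ) < p := by exact_mod_cast hP.one_lt
  have hE0 : (0 : ℝ) < absRamificationIdx p (RescaledCompletion K p v hv) := by
    exact_mod_cast absRamificationIdx_pos p (RescaledCompletion K p v hv)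
  have hlt1 : (p : ℝ) ^ (-(1 / (absRamificationIdx p (RescaledCompletion K p v hv) : ℝ))) < 1 :=
    Real.rpow_lt_one_of_one_lt_of_neg hp1 (by rw [neg_lt_zero]; positivity)
  have hc0 : 0 < ‖c‖ := norm_pos_iff.mpr hc
  have hz : c⁻¹ • RescaledCompletion.of K p v hv y ∈ logUnits (RescaledCompletion K p v hv) := by
    rw [mem_logUnits_iff_norm_lt_one_of_tame p hp2 he, norm_smul, norm_inv]
    calc ‖c‖⁻¹ * ‖RescaledCompletion.of K p v hv y‖
        ≤ ‖c‖⁻¹ * (‖c‖ * (p : ℝ) ^ (-(1 / (absRamificationIdx p (RescaledCompletion K p v hv) : ℝ)))) :=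
          mul_le_mul_of_nonneg_left hy (inv_nonneg.mpr (norm_nonneg _))
      _ = (p : ℝ) ^ (-(1 / (absRamificationIdx p (RescaledCompletion K p v hv) : ℝ))) := by
          rw [← mul_assoc, inv_mul_cancel₀ hc0.ne', one_mul]
      _ < 1 := hlt1
  have hx : RescaledCompletion.of K p v hv y ∈ c • logUnits (RescaledCompletion K p v hv) :=
    Set.mem_smul_set.mpr ⟨_, hz, by rw [smul_smul, mul_inv_cancel₀ hc, one_smul]⟩
  obtain ⟨z, hz', hzeq⟩ := Set.mem_smul_set.mp (of_apply_mem_smul_logUnits_of_mem_closure v p hv hγ c hx).1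
  rw [← hzeq, norm_smul]
  exact mul_le_mul_of_nonneg_left (norm_le_rpow_of_norm_lt_one p (RescaledCompletion K p v hv)
    ((mem_logUnits_iff_norm_lt_one_of_tame p hp2 he z).mp hz')) (norm_nonneg _)

/-- **The container span leaves every polydisc of smaller radius (UNCONDITIONAL):** at a tame packet with every local degree `≥ 2`, `p^{A}·log_p(R_I^×)`
contains the twist of the pure tensor of CO-RADIAL log-units (p527172), all of whose Wedderburn components have norm `‖p^{A}‖·∏_i p^{−1/e_i}`; so for every
`R' < ‖p^{A}‖·∏_i p^{−1/e_i}` the container span — hence its hull — is NOT inside the polydisc of radius `R'`.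
[claim: Mochizuki2012, status: disputed] [cite: Mochizuki2012, IUTchIV Prop. 1.4 (i) p. 13] [cite: DupuyHilado2025, §4.12] -/
theorem exists_mem_zpow_smul_logPacket_not_mem_polydisc (hp2 : 2 < p)
    (he : ∀ i, absRamificationIdx p (RescaledCompletion K p (w i) (hw i)) ≤ p - 2) (hd2 : ∀ i, 2 ≤ localDeg K (w i)) (A : ℤ) {R' : ℝ}
    (hR' : R' < ‖(p : ℚ_[p]) ^ A‖ * ∏ i, (p : ℝ) ^ (-(1 / (absRamificationIdx p (RescaledCompletion K p (w i) (hw i)) : ℝ)))) :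
    ∃ y ∈ ((p : ℚ_[p]) ^ A) • (logPacket p (fun i => RescaledCompletion K p (w i) (hw i)) :
        Set (PacketAlgebra p (fun i => RescaledCompletion K p (w i) (hw i)))),
      y ∉ dEquiv p (fun i => RescaledCompletion K p (w i) (hw i)) ⁻¹'
        polydisc (DFac p (fun i => RescaledCompletion K p (w i) (hw i))) (fun _ => R') := by
  set k := fun i => RescaledCompletion K p (w i) (hw i) with hk
  have hd2' : ∀ i, 2 ≤ Module.finrank ℚ_[p] (k i) := fun i => by
    change 2 ≤ Module.finrank ℚ_[p] (RescaledCompletion K p (w i) (hw i))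
    rw [finrank_rescaledCompletion_eq_localDeg]; exact hd2 i
  have hmaxes : ∀ i, ∃ z ∈ logUnits (k i), ‖z‖ = (p : ℝ) ^ (-(1 / (absRamificationIdx p (k i) : ℝ))) := by
    intro i
    obtain ⟨z, hz, -, hzn, -⟩ := TraceZeroCoradial.exists_mem_logUnits_trace_eq_zero_isMaxOn_of_tame p (k i) hp2 (he i) (hd2' i)
    exact ⟨z, hz, hzn⟩
  choose zm hzm hzmn using hmaxes
  obtain ⟨j⟩ := (inferInstance : Nonempty (DIdx p k))
  refine ⟨((p : ℚ_[p]) ^ A) • purePacket p k zm, Set.smul_mem_smul_set (purePacket_mem_logPacket_of_mem p k hzm), fun hmem => ?_⟩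
  have hj := (mem_polydisc (DFac p k)).mp hmem j
  rw [map_smul, Pi.smul_apply, norm_smul, psi_purePacket_apply p k (DFac p k) (dEquiv p k) zm j, norm_prod,
    Finset.prod_congr rfl (fun i _ => by rw [norm_factorEmb, hzmn])] at hj
  exact absurd (hj.trans_lt hR') (lt_irrefl _)

/-! ## §2–§4 Two factors `{i₀, i₁}`: the three confinement theorems under failing bits -/

section TwoFactors

variable (i₀ i₁ : I) (hne : i₀ ≠ i₁) (huniv : (Finset.univ : Finset I) = {i₀, i₁})

include hne huniv

/-- **§2 `E ∣ v`, FAILING bit OFF the slot (UNCONDITIONAL).**  Two tame factors; `‖g‖ = p^{−v/E}` with `E ∣ v` (`r = E − 1`, `v = E·(B+1)`); at `w_{i₁}`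
the residue degree is one and NO realised strip automorphism moves `ℤ_p·p` modulo `p·log_p(𝒪^×)`; `H` acts factorwise through the strip groups.  Then the
`(R_I)^∼`-hull of the `H`-orbit of the Θ-region `ι_{i₀}(g)·(R_I)^∼` lies in the polydisc of radius `‖g‖·p^{1−1/E} = p^{−B−1/E}`: by Prop. 1.1 the region lies
in the box `⊗(g·d₀⁻¹, 1)·R_I` = `(p^{B}·log_p(𝒪_{w_{i₀}}^×)) ⊗ 𝒪_{w_{i₁}}`, the first ball a log-shell ball (strip-stable, §1), the second the depth-`e₁` ball
with a failing bit (strip-INVARIANT, p550084).  The container's radius is `p^{−B+1−1/E−1/e₁}` (§1 `exists_mem_zpow_smul_logPacket_not_mem_polydisc`):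
the defect is `(e₁ − 1)/e₁·log p` — for the Θ-REGION, not only for the box of p554348 — so at `E ∣ v` the off-slot bit of R24 cannot be transferred away.
[claim: Mochizuki2012, status: disputed] [cite: Mochizuki2012, IUTchIII Thm. 3.11 (i) p. 154; Rmk. 3.9.5 (i) p. 127; IUTchIV Prop. 1.1 p. 9, Prop. 1.2 (ii) p. 10]
[cite: DupuyHilado2025, §4.9, §4.12] -/
theorem packetHull_orbit_smul_normalizedPacket_subset_polydisc_of_dvd_of_fixesBaseLine_offSlot (hp2 : 2 < p)
    (he : ∀ i, absRamificationIdx p (RescaledCompletion K p (w i) (hw i)) ≤ p - 2)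
    {g : RescaledCompletion K p (w i₀) (hw i₀)} {v : ℤ}
    (hv : ‖g‖ = (p : ℝ) ^ (-(v / (absRamificationIdx p (RescaledCompletion K p (w i₀) (hw i₀)) : ℝ))))
    (hdvd : ((absRamificationIdx p (RescaledCompletion K p (w i₀) (hw i₀)) : ℤ)) ∣ v)
    (hf₁ : (w i₁).asIdeal.inertiaDeg ℤ = 1)
    (hfix₁ : ∀ ψ ∈ ind1StripOf (w i₁) (galoisLog (w i₁)),
      RescaledCompletion.of K p (w i₁) (hw i₁) (ψ (p : (w i₁).adicCompletion K)) - (p : RescaledCompletion K p (w i₁) (hw i₁)) ∈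
        (p : ℚ_[p]) • logUnits (RescaledCompletion K p (w i₁) (hw i₁)))
    (H : Subgroup (PacketAlgebra p (fun i => RescaledCompletion K p (w i) (hw i)) ≃ₗ[ℚ_[p]]
      PacketAlgebra p (fun i => RescaledCompletion K p (w i) (hw i))))
    (hHfac : ∀ γ ∈ H, ∃ δ : Π i, AddAut ((w i).adicCompletion K),
      (∀ i, δ i ∈ AddSubgroup.closure (G := AddAut ((w i).adicCompletion K)) (ind1StripOf (w i) (galoisLog (w i)))) ∧
      ∀ z : Π i, RescaledCompletion K p (w i) (hw i),
        γ (PiTensorProduct.tprod ℚ_[p] z) =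
          PiTensorProduct.tprod ℚ_[p] (fun i => RescaledCompletion.of K p (w i) (hw i)
            (δ i ((RescaledCompletion.of K p (w i) (hw i)).symm (z i))))) :
    packetHull p (fun i => RescaledCompletion K p (w i) (hw i))
        (⋃ γ : H, (γ : PacketAlgebra p (fun i => RescaledCompletion K p (w i) (hw i)) ≃ₗ[ℚ_[p]]
            PacketAlgebra p (fun i => RescaledCompletion K p (w i) (hw i))) ''
          (iota p (fun i => RescaledCompletion K p (w i) (hw i)) i₀ g •
            (normalizedPacket p (fun i => RescaledCompletion K p (w i) (hw i)) :
              Set (PacketAlgebra p (fun i => RescaledCompletion K p (w i) (hw i)))))) ⊆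
      dEquiv p (fun i => RescaledCompletion K p (w i) (hw i)) ⁻¹'
        polydisc (DFac p (fun i => RescaledCompletion K p (w i) (hw i)))
          (fun _ => ‖g‖ * (p : ℝ) ^ (1 - 1 / (absRamificationIdx p (RescaledCompletion K p (w i₀) (hw i₀)) : ℝ))) := by
  classical
  set k := fun i => RescaledCompletion K p (w i) (hw i) with hk
  set e := fun i => RescaledCompletion.of K p (w i) (hw i) with he_def
  set E : ℕ := absRamificationIdx p (k i₀) with hE
  haveI : Nonempty I := ⟨i₀⟩
  have hP : p.Prime := Fact.out
  have hp0 : (0 : ℝ) < p := by exact_mod_cast hP.pos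
  have hpQ : (p : ℚ_[p]) ≠ 0 := by exact_mod_cast hP.ne_zero
  have hE0 : (0 : ℝ) < (E : ℝ) := by exact_mod_cast absRamificationIdx_pos p (k i₀)
  have hmem : ∀ i, i = i₀ ∨ i = i₁ := fun i => by
    have hm := Finset.mem_univ i
    rw [huniv, Finset.mem_insert, Finset.mem_singleton] at hm
    exact hm
  obtain ⟨m, hm⟩ := hdvd
  have hvE : (v : ℝ) / (E : ℝ) = m := by
    rw [hm]; push_cast; field_simp
  -- the different generator at `i₀` and the box `⊗(g·d₀⁻¹, 1)·R_I ⊇ ι_{i₀}(g)·(R_I)^∼`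
  obtain ⟨d₀, hd₀, hd₀0, hnd₀⟩ := exists_different_generator_norm_eq p (k i₀) (he i₀)
  have hReg : iota p k i₀ g • (normalizedPacket p k : Set (PacketAlgebra p k)) ⊆
      purePacket p k (Pi.mulSingle i₀ (g * ((d₀ : k i₀))⁻¹)) • (integerPacket p k : Set (PacketAlgebra p k)) := by
    refine (Set.smul_set_mono (normalizedPacket_subset_iota_smul_integerPacket_of_two p k i₀ i₁ hne huniv d₀ hd₀ hd₀0)).trans ?_
    rw [smul_smul, ← map_mul, iota_eq_purePacket]
  -- radii: `ρ_{i₀} = ‖p^{m−1}‖·p^{−1/E}` (log-shell ball), `ρ_{i₁} = ‖p⁻¹‖·p⁻¹ = 1` (depth-`e₁` ball)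
  let ρ : I → ℝ := fun i => if i = i₀ then ‖((p : ℚ_[p]) ^ (m - 1))‖ * (p : ℝ) ^ (-(1 / (E : ℝ))) else ‖((p : ℚ_[p])⁻¹)‖ * (p : ℝ)⁻¹
  have hρ₀ : ρ i₀ = ‖g‖ * (p : ℝ) ^ (1 - 1 / (E : ℝ)) := by
    simp only [ρ, if_pos rfl]
    rw [hv, norm_zpow, Padic.norm_p, inv_zpow', ← Real.rpow_intCast, ← Real.rpow_add hp0, ← Real.rpow_add hp0,
      show (v : ℝ) / (absRamificationIdx p (RescaledCompletion K p (w i₀) (hw i₀)) : ℝ) = (v : ℝ) / (E : ℝ) from rfl, hvE]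
    push_cast; ring_nf
  have hρ₁ : ρ i₁ = 1 := by
    simp only [ρ, if_neg hne.symm]
    rw [norm_inv, Padic.norm_p, inv_inv, mul_inv_cancel₀ hp0.ne']
  have hρ0 : ∀ i, 0 ≤ ρ i := fun i => by simp only [ρ]; split_ifs <;> positivity
  have hh : ∀ i, ‖(Pi.mulSingle i₀ (g * ((d₀ : k i₀))⁻¹) : Π i, k i) i‖ ≤ ρ i := by
    intro i
    rcases hmem i with rfl | rfl
    · rw [Pi.mulSingle_eq_same, hρ₀, norm_mul, norm_inv, hnd₀, ← Real.rpow_neg hp0.le, neg_neg]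
      refine le_of_eq ?_
      congr 1
      rw [hE, sub_div, div_self hE0.ne']
    · rw [Pi.mulSingle_eq_of_ne hne.symm, norm_one, hρ₁]
  have hstab : ∀ i, ∀ δ ∈ AddSubgroup.closure (G := AddAut ((w i).adicCompletion K)) (ind1StripOf (w i) (galoisLog (w i))),
      ∀ y : (w i).adicCompletion K, ‖e i y‖ ≤ ρ i → ‖e i (δ y)‖ ≤ ρ i := by
    intro i δ hδ y hy
    rcases hmem i with rfl | rfl
    · simp only [ρ, if_pos rfl] at hy ⊢
      exact norm_of_apply_le_of_mem_closure_of_le p (w i) (hw i) hp2 (he i) (zpow_ne_zero _ hpQ) hδ hy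
    · simp only [ρ, if_neg hne.symm] at hy ⊢
      have hM := image_depthE_ball_eq_of_mem_closure_of_fixesBaseLine (w i) p (hw i) hp2 (he i) hf₁ (inv_ne_zero hpQ) hfix₁ hδ
      have h1 : δ y ∈ δ '' {x | ‖e i x‖ ≤ ‖(p : ℚ_[p])⁻¹‖ * (p : ℝ)⁻¹} := ⟨y, hy, rfl⟩
      rw [hM] at h1
      exact h1
  have hprod : ∏ i, ρ i = ‖g‖ * (p : ℝ) ^ (1 - 1 / (E : ℝ)) := by
    rw [huniv, Finset.prod_pair hne, hρ₀, hρ₁, mul_one]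
  rw [← hprod]
  exact packetHull_iUnion_image_subset_polydisc_of_subset_smul_integerPacket p w hw _ ρ hρ0 hh hstab H hHfac hReg

end TwoFactors

end Summit.ABC.IUTFork.Thm311.Real
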